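import Literature.AlgebraicGeometry.Motives.KodairaDimension
import Literature.AlgebraicGeometry.HodgeTheory.MotivatedClasses
import HarnessLib

/-!
# Tankeev 2011 (main theorem): Grothendieck's `B(X)` for smooth complex projective threefolds of
# Kodaira dimension `κ(X) < 3` (named fact, statement only)

Family `hodge`, layer `Literature/AlgebraicGeometry/Tankeev2011`. S. G. Tankeev, *On the standard
conjecture of Lefschetz type for complex projective threefolds. II*, Izv. Math. **75**:5 (2011) 1047–1062
[Tankeev2011] (part I: Izv. Math. **74**:1 (2010)). The primary text is paywalled (cell `hodge-nonav`
acquisition requests acq-05756 / acq-08642 open); the main theorem is recorded from THREE concordant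
secondary statements, all read:

* zbMATH review Zbl 1234.14009 of [Tankeev2011], verbatim: "The author proves that A. Grothendieck's
  standard conjecture `B(X)` of Lefschetz type on the algebraicity of the operators `⋆` and `Λ` […] holds
  for all smooth complex projective threefolds `X` of Kodaira dimension `κ(X) < 3`. Based on the fact
  that, if there is a dominant rational map `X → Y`, then the validity of `B(X)` implies that of `B(Y)`,
  the validity of the conjecture for the case when `κ(X) = -∞` follows from a well-known theorem due to
  Miyaoka that such a threefold is uniruled. When `κ(X) = 1, 2`, the author reduces the assertion to that
  for fibred threefolds and proves the latter by a careful analysis of the structure of fibering. For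
  the case when `κ(X) = 0`, he proves the assertion by focusing on the structure of the Albanese
  morphism."
* the AUTHOR's own restatement, S. G. Tankeev, Sib. Èlektron. Mat. Izv. **17** (2020) 89–125
  [Tankeev2020], Introduction (held text p0002 L17–19), verbatim: "It is known that the standard
  conjecture `B(X)` is true for all smooth complex projective curves, surfaces, Abelian varieties [6] and
  threefolds of Kodaira dimension `κ(X) < 3` [7]" (`[7]` = [Tankeev2011]);
* A. J. de Jong, A. Perry, *The period-index problem and Hodge theory*, arXiv:2212.12971 (held text
  p0004 L3–6): "the Lefschetz standard conjecture is known in all degrees when `X` is […] a threefold of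
  Kodaira dimension less than `3` [tankeev-I, tankeev-II]".

## Lean rendering (ONE named fact, no theorem claimed)

`B(X)` is rendered, as everywhere in the tree (`Tankeev2011/LefschetzStandardAbelianSurfacePencils`,
`HodgeTheory/MotivatedClasses`), by André's `⋆_L`-form `HodgeTheory.StandardConjectureBStar 3 X η` for
every `η ∈ H²(X(ℂ); ℂ)` (vacuous unless `η` is a polarisation class; for a polarisation class, the
Lefschetz involution `⋆_L` is induced by algebraic correspondences — equivalent to Grothendieck's `B(X)` by
André 1996 Prop. 1.2, `ℚ[L, ⋆_L] = ℚ[L, Λ]`). "Kodaira dimension `κ(X) < 3`" for a smooth complex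
projective threefold is "`K_X` is not big", i.e. `¬ Motives.IsOfGeneralType 3 X` (tree
`Motives/KodairaDimension`: Fujino 2020, Def. 2.3.25–2.3.26 with Remark 2.3.17 — `κ(X, K_X) ≤ dim X`
always, and `= dim X` iff `K_X` big iff `X` of general type).

* `Tankeev2011_lefschetzStandard_threefold_kodairaDim_lt_three` — the main theorem, full printed scope.
  The earlier tree fact `Tankeev2011_lefschetzStandard_abelianSurfacePencilThreefold` (compact pencils
  of abelian surfaces) is the special case print itself names; deducing it from the present fact needs
  `κ ≤ 1` for such pencils (easy addition, Fujino Lemma 2.3.31), not in the tree — so no implication is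
  claimed here.

## References
* [Tankeev2011] Izv. Math. 75:5 (2011) 1047–1062, main theorem; zbMATH Zbl 1234.14009.
* [Tankeev2020] Sib. Èlektron. Mat. Izv. 17 (2020) 89–125, Introduction pp. 89–90.
* [deJongPerry2022] arXiv:2212.12971, §1 (list of known cases).
* [Fujino2020] §2.3.2, Def. 2.3.25–2.3.26 (big, general type).
* [Andre1996Motifs] Prop. 1.2 (`⋆_L` versus `Λ`).
-/

noncomputable section

namespace Literature.AlgebraicGeometry.Tankeev2011

open Literature.AlgebraicGeometry.Motives Literature.AlgebraicGeometry.HodgeTheory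

/-- **Tankeev 2011, main theorem: Grothendieck's standard Lefschetz-type statement `B(X)` holds for
every smooth complex projective threefold of Kodaira dimension `κ(X) < 3`** — print (zbMATH Zbl 1234.14009,
verbatim up to the bracket): "[`B(X)`] holds for all smooth complex projective threefolds `X` of Kodaira
dimension `κ(X) < 3`"; restated by the author (Tankeev 2020, Introduction: "`B(X)` is true for all smooth
complex projective […] threefolds of Kodaira dimension `κ(X) < 3` [7]") and by de Jong–Perry 2022 §1.
Rendering: `X` smooth projective of dimension `3` over `ℂ` (`IsSmoothProjective 3 X`, geometrically
irreducible) with `K_X` NOT big (`¬ IsOfGeneralType 3 X`, i.e. `κ(X) ≤ 2`) ⇒ for every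
`η ∈ H²(X(ℂ); ℂ)` the tree's `⋆_L`-algebraicity predicate for `(X, η)` (André's form of `B(X)`: the
Lefschetz involution `⋆_L` of a polarisation class is induced by algebraic correspondences; vacuous
unless `η` is a polarisation class). A THEOREM in print (status: proved; primary text paywalled,
acq-05756 — statement taken from the three concordant secondary sources quoted in the module
docstring); users take it as the hypothesis `(h : Tankeev2011_lefschetzStandard_threefold_kodairaDim_lt_three)`.
[cite: Tankeev2011, main theorem; Zbl 1234.14009] [cite: Tankeev2020, Introduction pp. 89–90]
[cite: deJongPerry2022, §1 (known cases of the Lefschetz standard statement)]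
[cite: Fujino2020, Definition 2.3.26 with Definition 2.3.25 (κ < dim ⟺ K_X not big)]
[cite: Andre1996Motifs, Prop. 1.2 (p. 11)] -/
def Tankeev2011_lefschetzStandard_threefold_kodairaDim_lt_three : Prop :=
  ∀ ⦃X : SchemeOver ℂ⦄, IsSmoothProjective 3 X → ¬ IsOfGeneralType 3 X →
    ∀ η : complexBetti X 2, StandardConjectureBStar 3 X η

end Literature.AlgebraicGeometry.Tankeev2011

end
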